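/-
Origin: expansion seat `planner-pub-hodgecm-toy2-g8-0`, handover #4 2026-08-18T15:21:34Z (`HOME/pub-hodgecm-toy2-g8/lean/Toy2g8/HsMod.lean`, md5 e23a69c6, 362 lines);
landed by the gen-8 packager in gate run 31 as `HodgeCM/Model/Toy/HsMod.lean` (import ^import Toy2g8\.HsGen[ \t]*$→import HodgeCM.Model.Toy.HsGen ×1).
-/
/-
Origin: CONSISTENCY seat 2 gen 8 `planner-pub-hodgecm-toy2-g8-0` (unit `pub-hodgecm-toy2-g8`), WIP
`HOME/pub-hodgecm-toy2-g8/lean/Toy2g8/HsMod.lean`; intended target `HodgeCM/Model/Toy/HsMod.lean` (new leaf).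
-/
import Mathlib
import Summits.HodgeConjecture.HodgeCM.Model.Toy.BalMod
import Summits.HodgeConjecture.HodgeCM.Model.Toy.F4Fails
import Summits.HodgeConjecture.HodgeCM.Model.ToyG2.Gysin3_2
import Summits.HodgeConjecture.HodgeCM.Model.ToyG2.DescentFacts3_2
import Summits.HodgeConjecture.HodgeCM.Model.Toy.HsGen

/-!
# The sub-Hodge-structure modifier: the F4 row of the census WITH `hR` and F7d-B

Load-bearing census of `HodgeCM.Assembly.COR_CM_of_descentFactsB₄ (M) (hR) (hN1) (hN2) (h4 : F4) (h5) (hu) (hb : F7d-B)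
(hd) : HC_CM`, binder **F4** (`Fact_cupAlg`).  The gen-7 row (`HodgeCM.Model.Toy.F4Fails`) exhibits a model of all
the other binders EXCEPT F7d-B in which F4 and `HC_CM` fail (the pull-back-family modifier `U♭`; F7d-B in `U♭` is
open).  Here F7d-B is obtained as well:

**`descentFactsB₄_realised_all_but_F4`** — there is a universe satisfying the 28 model axioms, `RealisationExistsFace`,
N1, N2, N3, N4, F5, `Fact_dimProd`, F-H0 **and F7d-B** in which F4 FAILS and `HC_CM` FAILS; hence
(`COR_CM_of_descentFactsB₄_needs_F4`) the headline corollary with the binder `h4` deleted is NOT a theorem, and F4 is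
not derivable from the other nine binders (`not_F4_of_others_with_gysinDescentB`).

The model is the modifier `U^hs := (toyUniverse₃ 1 4).balMod hsFam ∅` (`HodgeCM.Model.Toy.BalMod`) for the
**sub-Hodge-structure family**: outside the full regime (`p ≤ 2 ∨ dim X ≤ p + 2`, where `hsFam = ⊤`),
`hsFam X p = hsGen X (2p+4) (2p)` (`HodgeCM.Model.Toy.HsGen`), the span of the pure-wedge spaces `⋀^{2p}(N ⊔ L_T)`
over all rational SUB-HODGE STRUCTURES `N ≤ H¹(X)` (`Obj.IsSubHS`, `HodgeCM.Model.Toy.SubHS`) and sets `T` of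
Picard-block leaves of `X` of total cost `rk N + 4·#T ≤ 2p + 4` (`L_T` = the lattice span of the leaves in `T`).
* pull-back closure (`hsFam_pull`): images of sub-HS under Hodge maps are sub-HS, block leaves go to block leaves or
  to `0` (block-admissibility); a full `Y` of dimension `≤ p + 2` has `H¹(Y) = N_atoms ⊔ L_blocks` of cost `2 dim Y`;
* **F7d-B** (`hsFam_balDescentB`): for a block pair `P = A × B` the tree's block contraction
  `κ = contr (2p) (2 dim B) ψ₁ ψ₂ τ` (`HodgeCM.Model.ToyG2.GysinMap`, `τ ω ≠ 0`) sends `p_A^* e ∪ p_B^* ω ↦ (τ ω) e`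
  and maps `⋀^{2p+2dim B}_N` into `⋀^{2p}_{ψ₁(N ∩ ker ψ₂)}` — or to `0` unless `rk (N ∩ ker ψ₂) ≤ rk N - 2 dim B`
  (`HodgeCM.Model.Toy.Contr`); `ψ₁(N ∩ ker ψ₂)` is again a sub-HS, of cost `≤ 2p + 4`;
* **`B³(A) = 0`** for the CM atom `A = A_{(ℚ(ζ₁₇),Φ)}` (`hsFam_cm_eq_bot`): a primitive CM type makes `H¹(A)` a SIMPLE
  rational Hodge structure (`IsSubHS.eq_bot_or_eq_top`), so an admissible `N` (rank `≤ 10 < 16`) is `0`;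
  whence `¬ HC_CM` (N1–N4 give a nonzero Hodge class in `B³(A)`, tree `hodgeClassesOf_three_ne_bot`) and `¬ F4`
  (tree `weightSpace_le_algC_of_lefChar_eq_zero₅` inside `U^hs`, as in `F4Fails`).
All proofs kernel-checked; nothing is cited; no hypotheses.
-/

noncomputable section

open scoped TensorProduct
open NumberField NumberField.ComplexEmbedding NumberField.InfinitePlace

namespace HodgeCM

open Literature.AlgebraicGeometry.Motives (CMType)
open CMTypeOps NonGalois

namespace Universe

variable {U : Universe} {B : (X : U.Var) → (p : ℕ) → Submodule ℚ (U.Coh X (2 * p))} {C : U.Var → Prop}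

/-! ### Generic facts on a modifier `U.balMod B C` whose family is `⊤` in the full regime -/

/-- M26 for `U.balMod B C`: the Gysin class lives in codimension `dim X - 2`, where `B = ⊤`. -/
theorem balMod_fact_gysin_surface_of_full (M : U.ModelAxioms)
    (hfull : ∀ (X : U.Var) (p : ℕ), p ≤ 2 ∨ U.dim X ≤ p + 2 → B X p = ⊤) :
    (U.balMod B C).Fact_gysin_surface := by
  intro S X f hS
  obtain ⟨c, hc, h⟩ := M.gysin_surface S X f hS
  refine ⟨c, ?_, h⟩
  show c ∈ U.alg X (U.dim X - 2) ⊓ B X (U.dim X - 2)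
  rw [hfull X _ (Or.inr (by omega))]
  exact Submodule.mem_inf.mpr ⟨hc, Submodule.mem_top⟩

/-- M28 for `U.balMod B C`: the target codimension `2` of the duality map is in the full regime. -/
theorem balMod_fact_algDuality_of_full (M : U.ModelAxioms)
    (hfull : ∀ (X : U.Var) (p : ℕ), p ≤ 2 ∨ U.dim X ≤ p + 2 → B X p = ⊤) :
    (U.balMod B C).Fact_algDuality := by
  intro K Φ
  obtain ⟨D, hD, hmap, hdiag⟩ := M.algDuality K Φ
  refine ⟨D, hD, ?_, hdiag⟩
  show (U.alg _ (U.dim (U.prod4 K Φ) - 2) ⊓ B _ (U.dim (U.prod4 K Φ) - 2)).map D ≤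
    U.alg (U.prod4 K Φ) 2 ⊓ B (U.prod4 K Φ) 2
  rw [hfull _ 2 (Or.inl le_rfl)]
  exact le_inf ((Submodule.map_mono inf_le_left).trans hmap) le_top

/-- `RealisationExistsFace` transfers verbatim to `U.balMod B C` (its data never mention `Alg` or the CM predicate). -/
theorem balMod_realisationExistsFace (h : U.RealisationExistsFace) : (U.balMod B C).RealisationExistsFace := by
  intro F hG h6 f ι₁ hf V
  obtain ⟨r⟩ := h F hG h6 f ι₁ hf V
  exact ⟨{ r with }⟩

/-- **`HC_CM` fails in `U.balMod B C`** at a CM variety `X` with `B^p(X) = 0` and a nonzero Hodge class in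
codimension `p`. -/
theorem not_hc_cm_balMod_of_eq_bot {X : U.Var} {p : ℕ} (hCM : U.IsCMAbelianVariety X) (hB : B X p = ⊥)
    (hne : U.hodgeClassesOf X p ≠ ⊥) : ¬ (U.balMod B C).HC_CM := by
  intro h
  have hle := ((balMod_hc_cm_iff (U := U) (B := B) (C := C)).mp h) X (Or.inl hCM) p
  rw [hB, inf_bot_eq] at hle
  exact hne (le_bot_iff.mp hle)

set_option smartUnfolding false in
/-- **F4 fails in `U.balMod B C`** as soon as `U` satisfies the model axioms, N1, N2, F5, the modifier satisfies the
model axioms, and `B³(A_{(F,Φ)}) = 0` for a CM atom with `F` Galois of degree `≥ 6`: F4 for the modifier would make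
the weight line of three conjugate pairs (Lefschetz character `0`, `lefChar_threePairs`) algebraic IN THE MODIFIER by
the tree's positive-degree Milne theorem `weightSpace_le_algC_of_lefChar_eq_zero₅`, but that line is nonzero
(`finrank_weightSpace_of_isHodgeWeight`).  Same proof as `not_fact_cupAlg_pbMod_of_inert` (`F4Fails`). -/
theorem not_fact_cupAlg_balMod_of_eq_bot (M : U.ModelAxioms) (MB : (U.balMod B C).ModelAxioms)
    (hN1 : U.Fact_cupExterior) (hN2 : U.Fact_cup_hodge) (h5 : U.Fact_cupAssoc) {F : CMField} [IsGalois ℚ F]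
    (h6 : 6 ≤ Module.finrank ℚ F) (Φ : CMType F) (hbot : B (U.cmProd F (fun _ : Fin (0 + 1) => Φ)) 3 = ⊥) :
    ¬ (U.balMod B C).Fact_cupAlg := by
  intro h4
  obtain ⟨w, hw⟩ := exists_three_places (F := F) h6
  have hS := isHodgeWeight_threePairs Φ hw
  have h1 : Module.finrank ℂ (U.weightSpace F (fun _ : Fin (0 + 1) => Φ) (fun _ => threePairs w) (2 * 3)) = 1 :=
    finrank_weightSpace_of_isHodgeWeight M hN1 (by norm_num) hS
  -- Milne in positive degree for the modifier (model axioms, N1, N2, F5 transfer; F4 is the assumption `h4`)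
  have hle := weightSpace_le_algC_of_lefChar_eq_zero₅ (U := U.balMod B C) MB
    ((balMod_fact_cupExterior_iff (U := U) (B := B) (C := C)).mpr hN1)
    (show (U.balMod B C).Fact_cup_hodge from hN2) h4
    (show (U.balMod B C).Fact_cupAssoc from h5) 2 5 (by norm_num) (lefChar_threePairs Φ hw)
  -- the algebraic classes of the modifier of codimension 3 on the atom vanish
  have hbot' : (U.balMod B C).alg (U.cmProd F (fun _ : Fin (0 + 1) => Φ)) 3 = ⊥ := by
    rw [balMod_alg, hbot, inf_bot_eq]
  have hzero : U.weightSpace F (fun _ : Fin (0 + 1) => Φ) (fun _ => threePairs w) (2 * 3) = ⊥ := by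
    rw [eq_bot_iff]
    intro x hx
    have hx' : x ∈ (U.balMod B C).weightSpace F (fun _ : Fin (0 + 1) => Φ) (fun _ => threePairs w) (5 + 1) := hx
    have h' : (U.castC (U.cmProd F (fun _ : Fin (0 + 1) => Φ)) (by norm_num : 5 + 1 = 2 * 3)) x ∈
        ((U.balMod B C).alg (U.cmProd F (fun _ : Fin (0 + 1) => Φ)) 3).baseChange ℂ := by
      have h := hle hx'
      rw [Submodule.mem_comap] at h
      unfold algC at h
      exact h
    rw [hbot', Submodule.baseChange_bot, Submodule.mem_bot] at h'
    exact (Submodule.mem_bot ℂ).mpr ((LinearEquiv.map_eq_zero_iff _).mp h')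
  rw [hzero, finrank_bot] at h1
  exact zero_ne_one h1

end Universe

end HodgeCM

namespace HodgeCM.ToyG2

open HodgeCM.Toy HodgeCM.Universe
open Literature.AlgebraicGeometry.Motives
open exteriorPower Module BlockGysin Obj₂

/-! ### The family `hsFam` on the generation-2 universe and its modifier -/


variable {D : HodgeData} {T : TraceSys} {pl : GBlocks}

local notation "U₃" => toyModel3With D T pl

/-- **the sub-Hodge-structure family**: `⊤` in the full regime `p ≤ 2 ∨ dim X ≤ p + 2`, else `hsGen X (2p+4) (2p)` -/
def hsFam (X : GObj) (p : ℕ) : Submodule ℚ (⋀[ℚ]^(2 * p) X.X.L) :=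
  if p ≤ 2 ∨ X.X.dim ≤ p + 2 then ⊤ else X.X.hsGen (2 * p + 4) (2 * p)

/-- (Ported verbatim from the HodgeCMPerL package; no docstring in the source.) -/
theorem hsFam_of_full {X : GObj} {p : ℕ} (h : p ≤ 2 ∨ X.X.dim ≤ p + 2) : hsFam X p = ⊤ := if_pos h

/-- (Ported verbatim from the HodgeCMPerL package; no docstring in the source.) -/
theorem hsFam_of_not_full {X : GObj} {p : ℕ} (h : ¬ (p ≤ 2 ∨ X.X.dim ≤ p + 2)) :
    hsFam X p = X.X.hsGen (2 * p + 4) (2 * p) :=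
  if_neg h

/-- degree transport does not change membership in `hsGen` -/
theorem castCoh_mem_hsGen_iff (X : GObj) {k l : ℕ} (h : k = l) (c : ℕ) (z : (U₃).Coh X k) :
    (U₃).castCoh X h z ∈ X.X.hsGen c l ↔ z ∈ X.X.hsGen c k := by
  subst h
  exact Iff.rfl

/-- **`hsFam` is closed under pull-back** -/
theorem hsFam_pull (X Y : GObj) (f : Hom₂ X.X Y.X) (p : ℕ) : (hsFam Y p).map (map (2 * p) f.lin) ≤ hsFam X p := by
  by_cases hX : p ≤ 2 ∨ X.X.dim ≤ p + 2
  · rw [hsFam_of_full hX]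
    exact le_top
  rw [hsFam_of_not_full hX]
  by_cases hY : p ≤ 2 ∨ Y.X.dim ≤ p + 2
  · rw [hsFam_of_full hY]
    have hYd : Y.X.dim ≤ p + 2 := hY.resolve_left fun h => hX (Or.inl h)
    exact top_map_le_hsGen f (by omega) (2 * p)
  · rw [hsFam_of_not_full hY]
    exact hsGen_map_le f _ _


/-- (Ported verbatim from the HodgeCMPerL package; no docstring in the source.) -/
theorem hsFam_cm_eq_bot {K : CMField} [IsGalois ℚ K] {Φ : CMType K} (hprim : Primitive K Φ) {p : ℕ} (hp : 2 < p)
    (hd : p + 2 < (cmObj₂ K Φ).dim) (hK : 2 * p + 4 < finrank ℚ K) : hsFam (GObj.cm K Φ) p = ⊥ := by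
  rw [hsFam_of_not_full (by change ¬ (p ≤ 2 ∨ (cmObj₂ K Φ).dim ≤ p + 2); omega)]
  exact hsGen_cmObj₂_eq_bot hprim hK (by omega)

/-! ### F7d-B for `hsFam`: the Gysin map of a block pair descends the family -/

/-- **the `B`-half of F7d-B for `hsFam`** in `toyModel3With D T pl` (given its model axioms, used for `dim` only). -/
theorem hsFam_balDescentB (M : (U₃).ModelAxioms) : (U₃).BalDescentB hsFam := by
  intro F n m Ξ pA pB hP ω hω p e he
  by_cases hA : p ≤ 2 ∨ (U₃).dim ((U₃).cmProd F (blkA Ξ)) ≤ p + 2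
  · rw [hsFam_of_full hA]
    exact Submodule.mem_top
  -- dimensions: `P` is outside the full regime in codimension `p + dim B`
  have hdF : (U₃).Fact_dimProd := fact3_dimProd D T pl
  have hdimP : (U₃).dim ((U₃).cmProd F Ξ) = (n + 1 + m + 1) * F.halfDegree := dim_cmProd M hdF F Ξ
  have hdimA : (U₃).dim ((U₃).cmProd F (blkA Ξ)) = (n + 1) * F.halfDegree := dim_cmProd M hdF F _
  have hdimB : (U₃).dim ((U₃).cmProd F (blkB Ξ)) = (m + 1) * F.halfDegree := dim_cmProd M hdF F _
  have hsum : (U₃).dim ((U₃).cmProd F Ξ) =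
      (U₃).dim ((U₃).cmProd F (blkA Ξ)) + (U₃).dim ((U₃).cmProd F (blkB Ξ)) := by
    rw [hdimP, hdimA, hdimB]; ring
  have hPfull : ¬ (p + (U₃).dim ((U₃).cmProd F (blkB Ξ)) ≤ 2 ∨
      (U₃).dim ((U₃).cmProd F Ξ) ≤ p + (U₃).dim ((U₃).cmProd F (blkB Ξ)) + 2) := by
    omega
  rw [hsFam_of_not_full hA]
  rw [hsFam_of_not_full hPfull, castCoh_mem_hsGen_iff] at he
  -- the block restrictions `ψ₁, ψ₂` of `H¹(P)` and their identities (as in `BlockGysin.fact3_gysin`)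
  have hA' : ∀ j, pA.lin ∘ₗ ((U₃).prj n (fun j => (U₃).cmAV F (Ξ (Fin.castAdd (m + 1) j))) j).lin =
      ((U₃).prj (n + 1 + m) (fun k => (U₃).cmAV F (Ξ k)) (Fin.castAdd (m + 1) j)).lin :=
    fun j => lin_comp_eq_of_pull_one pA _ _ (hP.1 j 1)
  have hB' : ∀ i, pB.lin ∘ₗ ((U₃).prj m (fun i => (U₃).cmAV F (Ξ (Fin.natAdd (n + 1) i))) i).lin =
      ((U₃).prj (n + 1 + m) (fun k => (U₃).cmAV F (Ξ k)) (Fin.natAdd (n + 1) i)).lin :=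
    fun i => lin_comp_eq_of_pull_one pB _ _ (hP.2 i 1)
  have h₁ := blockRes_comp_lin_self (D := D) (T := T) (pl := pl) (N := n + 1 + m) (n := n)
    (fun k => (U₃).cmAV F (Ξ k)) (Fin.castAdd (m + 1)) (Fin.castAdd_injective _ _) pA hA'
  have h₂ := blockRes_comp_lin_of_disjoint (D := D) (T := T) (pl := pl) (N := n + 1 + m) (n := n)
    (m := m) (fun k => (U₃).cmAV F (Ξ k)) (Fin.castAdd (m + 1)) (Fin.natAdd (n + 1))
    (fun j i => castAdd_ne_natAdd j i) pB hB'
  have h₃ := blockRes_comp_lin_self (D := D) (T := T) (pl := pl) (N := n + 1 + m) (n := m)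
    (fun k => (U₃).cmAV F (Ξ k)) (Fin.natAdd (n + 1)) (Fin.natAdd_injective _ _) pB hB'
  have hH₁ := isHodge_blockRes (D := D) (T := T) (pl := pl) (N := n + 1 + m) (n := n)
    (fun k => (U₃).cmAV F (Ξ k)) (Fin.castAdd (m + 1))
  have hH₂ := isHodge_blockRes (D := D) (T := T) (pl := pl) (N := n + 1 + m) (n := m)
    (fun k => (U₃).cmAV F (Ξ k)) (Fin.natAdd (n + 1))
  -- a functional detecting `ω`
  obtain ⟨τ, hτ⟩ : ∃ τ : (⋀[ℚ]^(2 * (U₃).dim ((U₃).cmProd F (blkB Ξ))) ((U₃).cmProd F (blkB Ξ)).X.L) →ₗ[ℚ] ℚ,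
      τ ω ≠ 0 := by
    -- (instances supplied by hand: instance search on `⋀ᵏ` of a leaf lattice is slow)
    haveI : Module.Free ℚ (⋀[ℚ]^(2 * (U₃).dim ((U₃).cmProd F (blkB Ξ))) ((U₃).cmProd F (blkB Ξ)).X.L) :=
      Module.Free.of_divisionRing ℚ _
    haveI : Module.Projective ℚ (⋀[ℚ]^(2 * (U₃).dim ((U₃).cmProd F (blkB Ξ))) ((U₃).cmProd F (blkB Ξ)).X.L) :=
      Module.Projective.of_free
    exact Module.Projective.exists_dual_ne_zero ℚ hω
  -- the contraction descends the generators and takes `p_A^* e ∪ p_B^* ω` to `(τ ω) • e`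
  have key := map_contr_hsGen_le (P := ((U₃).cmProd F Ξ).X) (A := ((U₃).cmProd F (blkA Ξ)).X)
    (B := ((U₃).cmProd F (blkB Ξ)).X) (isBlockFree_cmProd F Ξ) _ _ hH₁ hH₂ τ
    (le_of_eq (two_mul_dim_eq_finrank (isBlockFree_cmProd F (blkB Ξ))).symm)
    (2 * (p + (U₃).dim ((U₃).cmProd F (blkB Ξ))) + 4) (2 * p)
  have hmem : contr (2 * p) (2 * (U₃).dim ((U₃).cmProd F (blkB Ξ))) _ _ τ
      (wedge ℚ _ (2 * p) (2 * (U₃).dim ((U₃).cmProd F (blkB Ξ))) (map (2 * p) pA.lin e)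
        (map (2 * (U₃).dim ((U₃).cmProd F (blkB Ξ))) pB.lin ω)) ∈ _ :=
    key (Submodule.mem_map_of_mem he)
  rw [contr_wedge_map τ pA.lin pB.lin h₁ h₂ h₃ e ω,
    show 2 * (p + (U₃).dim ((U₃).cmProd F (blkB Ξ))) + 4 - 2 * (U₃).dim ((U₃).cmProd F (blkB Ξ)) = 2 * p + 4 by
      omega] at hmem
  exact (Submodule.smul_mem_iff _ hτ).mp hmem

/-! ### The modifier `U^hs` of `toyUniverse₃ 1 4` and the F4 row -/

/-- **the sub-Hodge-structure modifier** of `toyUniverse₃ 1 4` (CM predicate unchanged) -/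
abbrev hsUniverse₃ : Universe := (toyUniverse₃ 1 4).balMod hsFam (fun _ => False)

/-- the 28 model axioms hold in `U^hs` -/
theorem hsUniverse₃_modelAxioms : hsUniverse₃.ModelAxioms := by
  have M : (toyUniverse₃ 1 4).ModelAxioms := toyUniverse₃_modelAxioms_all 1 4
  have hfull : ∀ (X : (toyUniverse₃ 1 4).Var) (p : ℕ), p ≤ 2 ∨ (toyUniverse₃ 1 4).dim X ≤ p + 2 →
      hsFam X p = ⊤ := fun X p h => hsFam_of_full h
  refine ModelAxioms.balMod M (fun X Y f p => hsFam_pull X Y f p) (fun X x y _ _ => ?_) (fun X => ?_)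
    (balMod_fact_cmDominated M.cmDominated fun _ h => h.elim)
    (balMod_fact_gysin_surface_of_full M hfull) (balMod_fact_algDuality_of_full M hfull)
  · rw [hsFam_of_full (Or.inl le_rfl)]
    exact Submodule.mem_top
  · rw [hsFam_of_full (Or.inl (by norm_num))]
    exact le_top

/-- **F7d-B holds in `U^hs`** -/
theorem hsUniverse₃_fact_gysinDescentB : hsUniverse₃.Fact_gysinDescentB :=
  Fact_gysinDescentB.balMod (fact3_gysinDescentB _ _ (toyUniverse₃_modelAxioms_all 1 4))
    (hsFam_balDescentB (toyUniverse₃_modelAxioms_all 1 4))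

set_option smartUnfolding false in
/-- `B³ = 0` on the CM atom `A_{(ℚ(ζ₁₇),Φ)}` in `U^hs` -/
theorem hsFam_cyclo17_eq_bot (Φ : CMType cyclo17) :
    hsFam ((toyUniverse₃ 1 4).cmProd cyclo17 (fun _ : Fin (0 + 1) => Φ)) 3 = ⊥ := by
  haveI := cyclo17_isGalois
  have hdim : (cmObj₂ cyclo17 Φ).dim = 8 := by rw [dim_cmObj₂, cyclo17_finrank]
  exact hsFam_cm_eq_bot (cyclo17_primitive Φ) (by norm_num) (by omega) (by rw [cyclo17_finrank]; norm_num)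

set_option smartUnfolding false in
/-- **`HC_CM` fails in `U^hs`** -/
theorem hsUniverse₃_not_hc_cm : ¬ hsUniverse₃.HC_CM := by
  haveI := cyclo17_isGalois
  have M : (toyUniverse₃ 1 4).ModelAxioms := toyUniverse₃_modelAxioms_all 1 4
  have hN1 : (toyUniverse₃ 1 4).Fact_cupExterior := fact3_cupExterior exteriorHodgeData traceSys (gplOf 1 4)
  have hN2 : (toyUniverse₃ 1 4).Fact_cup_hodge := fact3_cup_hodge traceSys (gplOf 1 4)
  have hN3 : (toyUniverse₃ 1 4).Fact_pull_H0 := fact3_pull_H0 exteriorHodgeData traceSys (gplOf 1 4)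
  have hN4 : (toyUniverse₃ 1 4).Fact_hodge_F0 := fact3_hodge_F0 traceSys (gplOf 1 4)
  have h6 : 6 ≤ finrank ℚ cyclo17 := by rw [cyclo17_finrank]; norm_num
  have hX : (toyUniverse₃ 1 4).IsCMAbelianVariety
      ((toyUniverse₃ 1 4).cmProd cyclo17 (fun _ : Fin (0 + 1) => HodgeCM.stdCMType cyclo17)) :=
    (M.cmAV cyclo17 (HodgeCM.stdCMType cyclo17)).2.1
  exact not_hc_cm_balMod_of_eq_bot hX (hsFam_cyclo17_eq_bot _)
    (hodgeClassesOf_three_ne_bot M hN1 hN2 hN3 hN4 h6 _)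

/-- **F4 fails in `U^hs`** -/
theorem hsUniverse₃_not_fact_cupAlg : ¬ hsUniverse₃.Fact_cupAlg := by
  haveI := cyclo17_isGalois
  have M : (toyUniverse₃ 1 4).ModelAxioms := toyUniverse₃_modelAxioms_all 1 4
  have hN1 : (toyUniverse₃ 1 4).Fact_cupExterior := fact3_cupExterior exteriorHodgeData traceSys (gplOf 1 4)
  have hN2 : (toyUniverse₃ 1 4).Fact_cup_hodge := fact3_cup_hodge traceSys (gplOf 1 4)
  have h5 : (toyUniverse₃ 1 4).Fact_cupAssoc := fact3_cupAssoc exteriorHodgeData traceSys (gplOf 1 4)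
  have h6 : 6 ≤ finrank ℚ cyclo17 := by rw [cyclo17_finrank]; norm_num
  exact not_fact_cupAlg_balMod_of_eq_bot M hsUniverse₃_modelAxioms hN1 hN2 h5 h6 (HodgeCM.stdCMType cyclo17)
    (hsFam_cyclo17_eq_bot _)

set_option smartUnfolding false in
/-- **the profile of `U^hs`**: the 28 model axioms, `RealisationExistsFace`, N1, N2, N3, N4, F5, `Fact_dimProd`, F-H0
and F7d-B hold; F4 and `HC_CM` fail. -/
theorem hsUniverse₃_profile :
    hsUniverse₃.ModelAxioms ∧ hsUniverse₃.RealisationExistsFace ∧ hsUniverse₃.Fact_cupExterior ∧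
      hsUniverse₃.Fact_cup_hodge ∧ hsUniverse₃.Fact_pull_H0 ∧ hsUniverse₃.Fact_hodge_F0 ∧
      hsUniverse₃.Fact_cupAssoc ∧ hsUniverse₃.Fact_dimProd ∧ hsUniverse₃.Fact_unitH0 ∧
      hsUniverse₃.Fact_gysinDescentB ∧ ¬ hsUniverse₃.Fact_cupAlg ∧ ¬ hsUniverse₃.HC_CM := by
  have hR : (toyUniverse₃ 1 4).RealisationExistsFace := ThetaUiso.realisationExistsFace₃ 1 4 le_rfl (by norm_num)
  have hN1 : (toyUniverse₃ 1 4).Fact_cupExterior := fact3_cupExterior exteriorHodgeData traceSys (gplOf 1 4)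
  have hN2 : (toyUniverse₃ 1 4).Fact_cup_hodge := fact3_cup_hodge traceSys (gplOf 1 4)
  have hN3 : (toyUniverse₃ 1 4).Fact_pull_H0 := fact3_pull_H0 exteriorHodgeData traceSys (gplOf 1 4)
  have hN4 : (toyUniverse₃ 1 4).Fact_hodge_F0 := fact3_hodge_F0 traceSys (gplOf 1 4)
  have h5 : (toyUniverse₃ 1 4).Fact_cupAssoc := fact3_cupAssoc exteriorHodgeData traceSys (gplOf 1 4)
  have hd : (toyUniverse₃ 1 4).Fact_dimProd := fact3_dimProd exteriorHodgeData traceSys (gplOf 1 4)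
  have hu : (toyUniverse₃ 1 4).Fact_unitH0 := fact3_unitH0 exteriorHodgeData traceSys (gplOf 1 4)
  exact ⟨hsUniverse₃_modelAxioms, balMod_realisationExistsFace hR,
    (balMod_fact_cupExterior_iff (U := toyUniverse₃ 1 4) (B := hsFam) (C := fun _ => False)).mpr hN1,
    (balMod_fact_cup_hodge_iff (U := toyUniverse₃ 1 4) (B := hsFam) (C := fun _ => False)).mpr hN2,
    (balMod_fact_pull_H0_iff (U := toyUniverse₃ 1 4) (B := hsFam) (C := fun _ => False)).mpr hN3,
    (balMod_fact_hodge_F0_iff (U := toyUniverse₃ 1 4) (B := hsFam) (C := fun _ => False)).mpr hN4,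
    (balMod_fact_cupAssoc_iff (U := toyUniverse₃ 1 4) (B := hsFam) (C := fun _ => False)).mpr h5,
    (balMod_fact_dimProd_iff (U := toyUniverse₃ 1 4) (B := hsFam) (C := fun _ => False)).mpr hd,
    (balMod_fact_unitH0_iff (U := toyUniverse₃ 1 4) (B := hsFam) (C := fun _ => False)).mpr hu,
    hsUniverse₃_fact_gysinDescentB, hsUniverse₃_not_fact_cupAlg, hsUniverse₃_not_hc_cm⟩

/-- **The F4 row of the census, with `hR` and F7d-B.**  There is a universe satisfying the 28 model axioms,
`RealisationExistsFace`, N1, N2, N3, N4, F5, `Fact_dimProd`, F-H0 and F7d-B in which F4 `Fact_cupAlg` FAILS and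
`HC_CM` FAILS. -/
theorem descentFactsB₄_realised_all_but_F4 :
    ∃ U : Universe, U.ModelAxioms ∧ U.RealisationExistsFace ∧ U.Fact_cupExterior ∧ U.Fact_cup_hodge ∧
      U.Fact_pull_H0 ∧ U.Fact_hodge_F0 ∧ U.Fact_cupAssoc ∧ U.Fact_dimProd ∧ U.Fact_unitH0 ∧
      U.Fact_gysinDescentB ∧ ¬ U.Fact_cupAlg ∧ ¬ U.HC_CM :=
  ⟨hsUniverse₃, hsUniverse₃_profile⟩

/-- **Census form: the binder `h4 : F4` cannot be deleted from `COR_CM_of_descentFactsB₄`** — the corollary with the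
other nine binders (`M, hR, hN1, hN2, h5, hu, hb, hd`) is not a theorem. -/
theorem COR_CM_of_descentFactsB₄_needs_F4 :
    ¬ ∀ U : Universe, U.ModelAxioms → U.RealisationExistsFace → U.Fact_cupExterior → U.Fact_cup_hodge →
      U.Fact_cupAssoc → U.Fact_unitH0 → U.Fact_gysinDescentB → U.Fact_dimProd → U.HC_CM := by
  intro h
  obtain ⟨U, M, hR, hN1, hN2, -, -, h5, hd, hu, hb, -, hHC⟩ := descentFactsB₄_realised_all_but_F4
  exact hHC (h U M hR hN1 hN2 h5 hu hb hd)

/-- F4 is NOT derivable from `ModelAxioms ∧ RealisationExistsFace ∧ N1 ∧ N2 ∧ N3 ∧ N4 ∧ F5 ∧ D ∧ F-H0 ∧ F7d-B`. -/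
theorem not_F4_of_others_with_gysinDescentB :
    ¬ ∀ U : Universe, U.ModelAxioms → U.RealisationExistsFace → U.Fact_cupExterior → U.Fact_cup_hodge →
      U.Fact_pull_H0 → U.Fact_hodge_F0 → U.Fact_cupAssoc → U.Fact_dimProd → U.Fact_unitH0 →
      U.Fact_gysinDescentB → U.Fact_cupAlg := by
  intro h
  obtain ⟨U, M, hR, hN1, hN2, hN3, hN4, h5, hd, hu, hb, h4, -⟩ := descentFactsB₄_realised_all_but_F4
  exact h4 (h U M hR hN1 hN2 hN3 hN4 h5 hd hu hb)

end HodgeCM.ToyG2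

end
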